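import Summits.CriticalPhenomena.PercolationContinuityZ3.Theorems.PercNearOneGluingNoHeavyLowerTailKnQuestion8AntitheticApex
import HarnessLib

/-!
# `NoHeavyLowerTail` (crux stmt-CriticalPhenomena-4575), antithetic vdBHK programme: the HALF-DOUBLING LEMMA (tool T19) — the twisted double of an
# antipodal-Kleitman poset over a HALF is antipodal Kleitman

Support file (seat `prim-ineq-gen-7` gen 45; `--supports stmt-CriticalPhenomena-4575`).  No `sorry`, no definitions.
Memo: run/shared/lean/prim/prim-ineq-gen-7/FINDING-AK-g45.md §2.

SETTING.  `X` a finite partial order with an involution `ι`, antipodal Kleitman (AK) in the up-set form `#(V ∩ ι Y) ≤ #(V ∩ Y)` for all up-sets `V, Y`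
(as in `AntitheticApex`).  A HALF is a down-set `L` with `ι L = X ∖ L` (`x ∈ L ↔ ι x ∉ L`).  The TWISTED DOUBLE `X(X;L)` (conjecture TD of memo
FINDING-GLUE-g21; false for general down-sets, 10-element counterexample of g22) is `X × {0,1}` with `(s,i) ≤ (u,i) ⟺ s ≤ u` and the cross relations
`(s,i) ≤ (u,1-i) ⟺ s ≤ u ∧ s ∈ L ∧ u ∉ L` (for a half both cross directions have the same condition), involution `(s,i) ↦ (ι s, 1-i)`.  Its up-sets are
the pairs `(U₀,U₁)` of up-sets of `X` with the cross condition `x ∈ U_i ∩ L, x ≤ y, y ∉ L ⟹ y ∈ U_{1-i}`, and AK of `X(X;L)` reads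
`#(U₀ ∩ ιW₁) + #(U₁ ∩ ιW₀) ≤ #(U₀ ∩ W₀) + #(U₁ ∩ W₁)`.
* `AntitheticHalfDouble.half_double_ak` — **T19**: this inequality, for every AK `X` and every half `L`.  PROOF (piece principle): the two `ι`-invariant
  pieces `{(s,0) : s ∈ L} ∪ {(s,1) : s ∉ L}` and `{(s,1) : s ∈ L} ∪ {(s,0) : s ∉ L}` each carry ALL relations of `X`, so `P = (U₀ ∩ L) ∪ (U₁ ∖ L)` and
  `Q = (U₁ ∩ L) ∪ (U₀ ∖ L)` are up-sets of `X` and the AK sum of `X(X;L)` is EXACTLY the sum of the two AK sums of `X` at `(P_U,P_W)` and `(Q_U,Q_W)`.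
ANTIMATROID MEANING (memo §1–2): for `X = Ω_𝓕` (colouring poset of an antimatroid) and an ATOM `a`, `L = {a red}` is a half and `X(X;L) = Ω_{𝓕+z}` for a
new element `z` enabled exactly by `{a}`; so 'adding a leaf over one atom preserves AK' — e.g. the poset antimatroid of the N poset (`Λ` plus a leaf over one
minimal element) is AK.  More generally every self-dual monotone function of atom colours gives a half.
-/

namespace Summit.CriticalPhenomena.PercolationContinuityZ3.Theorems

open Finset

namespace AntitheticHalfDouble

variable {X : Type*} [DecidableEq X] [PartialOrder X]

/-- **HALF-DOUBLING (T19).**  `X` AK in up-set form, `ι` an involution, `L` a down-set with `x ∈ L ↔ ι x ∉ L`.  For all pairs `(U₀,U₁)`, `(W₀,W₁)` of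
up-sets of `X` satisfying the cross condition of the twisted double `X(X;L)` (`x ∈ U_i`, `x ∈ L`, `x ≤ y`, `y ∉ L` ⟹ `y ∈ U_{1-i}`, and the same for `W`):
`#(U₀ ∩ ιW₁) + #(U₁ ∩ ιW₀) ≤ #(U₀ ∩ W₀) + #(U₁ ∩ W₁)`, i.e. `X(X;L)` is antipodal Kleitman. [this work] -/
theorem half_double_ak (ι : X → X) (hιι : Function.Involutive ι)
    (hAK : ∀ V Y : Finset X, (∀ x y, x ≤ y → x ∈ V → y ∈ V) → (∀ x y, x ≤ y → x ∈ Y → y ∈ Y) →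
      (V ∩ Y.image ι).card ≤ (V ∩ Y).card)
    (L : Finset X) (hL : ∀ x, x ∈ L ↔ ι x ∉ L) (hLdown : ∀ x y, x ≤ y → y ∈ L → x ∈ L)
    (U₀ U₁ W₀ W₁ : Finset X)
    (hU₀ : ∀ x y, x ≤ y → x ∈ U₀ → y ∈ U₀) (hU₁ : ∀ x y, x ≤ y → x ∈ U₁ → y ∈ U₁)
    (hW₀ : ∀ x y, x ≤ y → x ∈ W₀ → y ∈ W₀) (hW₁ : ∀ x y, x ≤ y → x ∈ W₁ → y ∈ W₁)
    (hUc₀ : ∀ x y, x ≤ y → x ∈ L → y ∉ L → x ∈ U₀ → y ∈ U₁) (hUc₁ : ∀ x y, x ≤ y → x ∈ L → y ∉ L → x ∈ U₁ → y ∈ U₀)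
    (hWc₀ : ∀ x y, x ≤ y → x ∈ L → y ∉ L → x ∈ W₀ → y ∈ W₁) (hWc₁ : ∀ x y, x ≤ y → x ∈ L → y ∉ L → x ∈ W₁ → y ∈ W₀) :
    (U₀ ∩ W₁.image ι).card + (U₁ ∩ W₀.image ι).card ≤ (U₀ ∩ W₀).card + (U₁ ∩ W₁).card := by
  classical
  -- the two pieces: P = U₀ on L, U₁ off L;  Q = U₁ on L, U₀ off L
  set PU : Finset X := U₀.filter (fun x => x ∈ L) ∪ U₁.filter (fun x => x ∉ L) with hPU
  set QU : Finset X := U₁.filter (fun x => x ∈ L) ∪ U₀.filter (fun x => x ∉ L) with hQU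
  set PW : Finset X := W₀.filter (fun x => x ∈ L) ∪ W₁.filter (fun x => x ∉ L) with hPW
  set QW : Finset X := W₁.filter (fun x => x ∈ L) ∪ W₀.filter (fun x => x ∉ L) with hQW
  -- membership descriptions
  have memP : ∀ (A B : Finset X) (x : X), x ∈ A.filter (fun x => x ∈ L) ∪ B.filter (fun x => x ∉ L) ↔
      (x ∈ L ∧ x ∈ A) ∨ (x ∉ L ∧ x ∈ B) := by
    intro A B x
    simp only [Finset.mem_union, Finset.mem_filter]
    tauto
  -- up-set property of the pieces
  have upP : ∀ (A B : Finset X), (∀ x y, x ≤ y → x ∈ A → y ∈ A) → (∀ x y, x ≤ y → x ∈ B → y ∈ B) →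
      (∀ x y, x ≤ y → x ∈ L → y ∉ L → x ∈ A → y ∈ B) →
      ∀ x y, x ≤ y → x ∈ A.filter (fun x => x ∈ L) ∪ B.filter (fun x => x ∉ L) → y ∈ A.filter (fun x => x ∈ L) ∪ B.filter (fun x => x ∉ L) := by
    intro A B hA hB hAB x y hxy hx
    rw [memP] at hx ⊢
    rcases hx with ⟨hxL, hxA⟩ | ⟨hxL, hxB⟩
    · by_cases hyL : y ∈ L
      · exact Or.inl ⟨hyL, hA x y hxy hxA⟩
      · exact Or.inr ⟨hyL, hAB x y hxy hxL hyL hxA⟩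
    · have hyL : y ∉ L := fun h => hxL (hLdown x y hxy h)
      exact Or.inr ⟨hyL, hB x y hxy hxB⟩
  have hPUup := upP U₀ U₁ hU₀ hU₁ hUc₀
  have hQUup := upP U₁ U₀ hU₁ hU₀ hUc₁
  have hPWup := upP W₀ W₁ hW₀ hW₁ hWc₀
  have hQWup := upP W₁ W₀ hW₁ hW₀ hWc₁
  have akP := hAK PU PW hPUup hPWup
  have akQ := hAK QU QW hQUup hQWup
  -- split every cardinality along membership in L
  have split : ∀ (S : Finset X), S.card = (S.filter (fun x => x ∈ L)).card + (S.filter (fun x => x ∉ L)).card := by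
    intro S
    rw [Finset.card_filter_add_card_filter_not]
  have hιL : ∀ x, x ∉ L → ι x ∈ L := by
    intro x hx
    by_contra h
    have h2 : ι (ι x) ∉ L := by rw [hιι x]; exact hx
    exact h ((hL (ι x)).2 h2)
  have hιL' : ∀ x, x ∈ L → ι x ∉ L := fun x hx => (hL x).1 hx
  -- identification of the filtered pieces (positive terms)
  have pos1 : (PU ∩ PW).filter (fun x => x ∈ L) = (U₀ ∩ W₀).filter (fun x => x ∈ L) := by
    ext x; simp only [Finset.mem_filter, Finset.mem_inter, hPU, hPW, memP]; tauto
  have pos2 : (PU ∩ PW).filter (fun x => x ∉ L) = (U₁ ∩ W₁).filter (fun x => x ∉ L) := by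
    ext x; simp only [Finset.mem_filter, Finset.mem_inter, hPU, hPW, memP]; tauto
  have pos3 : (QU ∩ QW).filter (fun x => x ∈ L) = (U₁ ∩ W₁).filter (fun x => x ∈ L) := by
    ext x; simp only [Finset.mem_filter, Finset.mem_inter, hQU, hQW, memP]; tauto
  have pos4 : (QU ∩ QW).filter (fun x => x ∉ L) = (U₀ ∩ W₀).filter (fun x => x ∉ L) := by
    ext x; simp only [Finset.mem_filter, Finset.mem_inter, hQU, hQW, memP]; tauto
  -- negative terms
  have neg1 : (PU ∩ PW.image ι).filter (fun x => x ∈ L) = (U₀ ∩ W₁.image ι).filter (fun x => x ∈ L) := by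
    ext x
    simp only [Finset.mem_filter, Finset.mem_inter, AntitheticApex.mem_image_invol ι hιι, hPU, hPW, memP]
    constructor
    · rintro ⟨⟨hxP, hιx⟩, hxL⟩
      have h1 : ι x ∉ L := hιL' x hxL
      refine ⟨⟨?_, ?_⟩, hxL⟩
      · rcases hxP with ⟨_, h⟩ | ⟨h, _⟩; exact h; exact absurd hxL h
      · rcases hιx with ⟨h, _⟩ | ⟨_, h⟩; exact absurd h h1; exact h
    · rintro ⟨⟨hxU, hιx⟩, hxL⟩
      exact ⟨⟨Or.inl ⟨hxL, hxU⟩, Or.inr ⟨hιL' x hxL, hιx⟩⟩, hxL⟩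
  have neg2 : (PU ∩ PW.image ι).filter (fun x => x ∉ L) = (U₁ ∩ W₀.image ι).filter (fun x => x ∉ L) := by
    ext x
    simp only [Finset.mem_filter, Finset.mem_inter, AntitheticApex.mem_image_invol ι hιι, hPU, hPW, memP]
    constructor
    · rintro ⟨⟨hxP, hιx⟩, hxL⟩
      have h1 : ι x ∈ L := hιL x hxL
      refine ⟨⟨?_, ?_⟩, hxL⟩
      · rcases hxP with ⟨h, _⟩ | ⟨_, h⟩; exact absurd h hxL; exact h
      · rcases hιx with ⟨_, h⟩ | ⟨h, _⟩; exact h; exact absurd h1 h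
    · rintro ⟨⟨hxU, hιx⟩, hxL⟩
      exact ⟨⟨Or.inr ⟨hxL, hxU⟩, Or.inl ⟨hιL x hxL, hιx⟩⟩, hxL⟩
  have neg3 : (QU ∩ QW.image ι).filter (fun x => x ∈ L) = (U₁ ∩ W₀.image ι).filter (fun x => x ∈ L) := by
    ext x
    simp only [Finset.mem_filter, Finset.mem_inter, AntitheticApex.mem_image_invol ι hιι, hQU, hQW, memP]
    constructor
    · rintro ⟨⟨hxP, hιx⟩, hxL⟩
      have h1 : ι x ∉ L := hιL' x hxL
      refine ⟨⟨?_, ?_⟩, hxL⟩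
      · rcases hxP with ⟨_, h⟩ | ⟨h, _⟩; exact h; exact absurd hxL h
      · rcases hιx with ⟨h, _⟩ | ⟨_, h⟩; exact absurd h h1; exact h
    · rintro ⟨⟨hxU, hιx⟩, hxL⟩
      exact ⟨⟨Or.inl ⟨hxL, hxU⟩, Or.inr ⟨hιL' x hxL, hιx⟩⟩, hxL⟩
  have neg4 : (QU ∩ QW.image ι).filter (fun x => x ∉ L) = (U₀ ∩ W₁.image ι).filter (fun x => x ∉ L) := by
    ext x
    simp only [Finset.mem_filter, Finset.mem_inter, AntitheticApex.mem_image_invol ι hιι, hQU, hQW, memP]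
    constructor
    · rintro ⟨⟨hxP, hιx⟩, hxL⟩
      have h1 : ι x ∈ L := hιL x hxL
      refine ⟨⟨?_, ?_⟩, hxL⟩
      · rcases hxP with ⟨h, _⟩ | ⟨_, h⟩; exact absurd h hxL; exact h
      · rcases hιx with ⟨_, h⟩ | ⟨h, _⟩; exact h; exact absurd h1 h
    · rintro ⟨⟨hxU, hιx⟩, hxL⟩
      exact ⟨⟨Or.inr ⟨hxL, hxU⟩, Or.inl ⟨hιL x hxL, hιx⟩⟩, hxL⟩
  have e1 := split (PU ∩ PW); have e2 := split (QU ∩ QW)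
  have e3 := split (PU ∩ PW.image ι); have e4 := split (QU ∩ QW.image ι)
  have e5 := split (U₀ ∩ W₀); have e6 := split (U₁ ∩ W₁)
  have e7 := split (U₀ ∩ W₁.image ι); have e8 := split (U₁ ∩ W₀.image ι)
  rw [pos1, pos2] at e1; rw [pos3, pos4] at e2; rw [neg1, neg2] at e3; rw [neg3, neg4] at e4
  omega

end AntitheticHalfDouble

end Summit.CriticalPhenomena.PercolationContinuityZ3.Theorems
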